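import Literature.MathematicalPhysics.QuantumFieldTheory.Balaban1983to89.B9Eq384LaplaceAkLipschitzTwoBackgrounds
import Literature.MathematicalPhysics.QuantumFieldTheory.Balaban1983to89.B9Eq3126H1BoundTower
import Literature.MathematicalPhysics.QuantumFieldTheory.Balaban1983to89.B9Eq315QTowerFlatRightInverse
import Literature.MathematicalPhysics.QuantumFieldTheory.Balaban1983to89.B9Eq386ResolventLetters

/-!
# `Balaban1983to89.B9Eq386LipschitzH1TowerTwoBackgrounds` — T. Bałaban, *Propagators for lattice gauge theories in a background field*, Commun.
# Math. Phys. **99** (1985) 389–434 [Balaban1985BackgroundPropagators] Thm 3.4 p. 400 ∕ (3.86) p. 407 with (3.126) p. 420 and (3.26) p. 395: AT `k`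
# LEVELS AND A FIXED LATTICE THE NE9 CHAIN's `G₁(U) = Δ_a(U)⁻¹` AND `H₁(U) = G₁Q_k†(Q_kG₁Q_k†)⁻¹` FOR PRINT's k-TH-STEP OPERATOR ARE LIPSCHITZ IN THE
# BACKGROUND BETWEEN TWO SMALL BACKGROUNDS — `‖G₁(U) − G₁(U′)‖ ≤ C₁·δ`, `‖H₁(U) − H₁(U′)‖ ≤ C₂·δ`: the one-step (Q2)₂
# `B9Eq386LipschitzH1TwoBackgrounds` (this lineage, gen 73) ONE STOREY UP, by the resolvent algebra of `B9Eq386ResolventLetters` on the k-level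
# letters `‖Δ_a(U) − Δ_a(U′)‖ ≤ C_Δ·δ` ((Q1)₂-k) and `‖Q_k(U) − Q_k(U′)‖ ≤ C_Q·δ` (`B9Eq315QTowerLipschitzTwoBackgrounds`), the owner's k-level
# coercivity ∕ operator bound (`B9Eq3126H1BoundTower`, sections-free by NE9 leaf-02) and explicit modulus of `Q_k(1)†` (`B9Eq315QTowerFlatRightInverse`)

statement-level skeleton of published theorems with citation tags; proofs where landed; nothing here is a claim about the Yang–Mills mass gap

PDF held: `paper:balaban1985-cmp99-background-propagators` (journal page = PDF page + 388); pp. 395, 400, 407, 420 through the verbatim quotations of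
`B9Eq386LipschitzH1` (NE9 owner gen 81), whose proof this file runs between two backgrounds at `k` levels.

CITATION HEADER (lean-in-tree rule 2026-08-18).  Audit cell `pub-balaban`, sub-cell `t4`, NE9 crux team (2): LEAF PROVER 04
(`b2b-balaban-t4-ne9-formalise-leaf-04` gen 74) — TOWER-SPECIES-PLAN §2 (e), the third junction above the k-level two-background averaging letters.

THE PRINT (as quoted in `B9Eq386LipschitzH1`).  p. 400, Thm 3.4: *«… describing these analytic extensions as small perturbations of the operators
depending on U only»*; p. 407, (3.86): *«G(U′U) = G(U)(I − V(A)G(U))⁻¹ = Σ_{n=0}^∞ G(U)(V(A)G(U))ⁿ»* — at a GENERAL `U`; p. 420, (3.126): *«HB = GQ*(QGQ*)⁻¹B»*,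
with print's `k`-level composite `Q` of (3.15).

WHAT IS PROVED (sorry-free; no `Prop` placeholder; no inequality of the paper asserted).
* **`exists_lipschitz_G1k_H1k_twoBackgrounds`** — for two tower profiles `α, α′` (`α_j, α′_j ≤ 1∕64`, FIXED before the `∃`: the coercivity constants of
  `B9Eq3126H1BoundTower` are per profile): `∃ C₁ C₂ ε₇ > 0 ∀ U U′` on `T_{L^{n+1} m}` with their tower data (`hU1 hreg hα2 hα128` ∕ primed), bonds AND
  level averages `U1`-valued, `ε`-small (`ε ≤ ε₇`), `δ`-close, `hRS`, `hRS′`, `∀ hpos hQ` (at `U`) `∀ hpos′ hQ′` (at `U′`):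
  `‖G₁(U)z − G₁(U′)z‖ ≤ C₁·δ·‖z‖` and `‖H₁(U)b − H₁(U′)b‖ ≤ C₂·δ·‖b‖` for `G1LatticeK`∕`H1LatticeK` at `Δ₁ := hessOp φ η V τ`, `Q := QkW … V …` —
  `norm_G1K_sub_le` ∕ `norm_H1K_sub_le` with: `γ₁ = min` of the two profiles' k-level coercivity constants (sections-free
  `exists_coercive_laplaceAk_of_small_field'`, its `ρ′`∕`δ_Q` slots discharged by `norm_QprimeTowerW_sub_flat_le` (majorised `C_ρK_Rε`,
  `C_ρ = (n+1)d(L−1)2^{d(L−1)(n+2)}c₀^{−1∕2}`) and `norm_QkW_sub_flat_le` (`C_Qε`)), `MT` (`norm_laplaceAk_le`) at both, `δT = C_Δ·δ` ((Q1)₂-k §2),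
  `δQ = C_{Q,2}·δ` (k-level two-background `δ_Q`, `δ ∧ 2ε ≤ δ`), `MQ = ‖Q_k(1)‖ + C_Q`, `μQ = μ_{Q_k(1)†}∕2` (the owner's EXPLICIT
  `exists_modulus_adjoint_QkW_one`).
MODEL / HONEST SCOPE.  [folklore] finite-dimensional perturbation theory at a FIXED lattice and number of levels; `C₁, C₂, ε₇` depend on `L, m, n, η, c₀, c₁, a,
M_φ, M_φ′, C_τ` and on the two profiles; both backgrounds AND their level averages in the small ball (DISPLAYED); the per-level regularity data
DISPLAYED; NOT analyticity in `A`, NOT uniformity in the lattice or in `k`, NOT `𝔊_k(U)` (the (Q3)₂-k twin; next); NOT summit progress (cell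
pub-balaban: NE9 NOT PRINTED ∕ NOT PROVED; spine PROVED 0∕9; rung (B)+1 finite T⁴ — NOT infinite volume, NOT mass gap, NOT BetaPertH, NOT Clay).  NEW file
importing `B9Eq384LaplaceAkLipschitzTwoBackgrounds`, `B9Eq3126H1BoundTower`, `B9Eq315QTowerFlatRightInverse`, `B9Eq386ResolventLetters`; nothing of the
NE9-owner ∕ leaf-02 lineages' files is modified.  Net new unproved facts: 0.
-/

noncomputable section

open scoped InnerProductSpace ComplexConjugate

namespace Literature.MathematicalPhysics.QuantumFieldTheory.Balaban1983to89.B9Eq386LipschitzH1TowerTwoBackgrounds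

open B4Sect5Torus (TSite)
open B9SectCLatticeCarrier (Bond)
open B7Prop1Explicit (U1 Wcx boxVec)
open B9Eq311L2Pairing (WL2)
open B9Eq319QprimeTorus (fineP)
open B11Eq103H1Complex (SiteL2K BondL2K covDerivL2K covDivL2K laplaceAK laplaceALatticeK H1LatticeK G1LatticeK adjoint_injective_of_surjective)
open B9Eq310HessianOperator (adTransportW hessOp)
open B9Eq315QTorus (perCfg cornerSite)
open B9Eq315QTower (towerP UlevOf)
open B9Eq315QTowerFlat (perCfg_UlevOf_one_mem_U1 norm_Wcx_UlevOf_one_sub_one_le)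
open B9Eq326OperatorTower (RofUk QkW QprimeTowerW laplaceAk)
open B9Eq373DerivativeRemainderL2 (norm_adjoint_apply_le)
open B9Eq3126GreenLetters (exists_modulus_of_injective adjoint_injective_of_modulus)
open B9Eq3126H1BoundTower (exists_coercive_laplaceAk_of_small_field' norm_laplaceAk_le)
open B9Eq386ResolventLetters (norm_G1K_sub_le norm_H1K_sub_le)
open B9Eq315QTowerLipschitz (norm_QkW_sub_flat_le norm_QprimeTowerW_sub_flat_le)
open B9Eq315QTowerLipschitzTwoBackgrounds (norm_QkW_sub_QkW_le)
open B9Eq315QTowerFlatRightInverse (exists_modulus_adjoint_QkW_one)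
open B9Eq384LaplaceAkLipschitzTwoBackgrounds (exists_laplaceAk_sub_laplaceAk_le)

/-- `K^N − 1 ≤ N(K − 1)K^N` for `K ≥ 1` (the tower's linear majorant; private copy). [folklore] -/
private theorem pow_sub_one_le_mul_pow {K : ℝ} (hK : 1 ≤ K) : ∀ N : ℕ, K ^ N - 1 ≤ N * (K - 1) * K ^ N
  | 0 => by simp
  | N + 1 => by
    have ih := pow_sub_one_le_mul_pow hK N
    have hK0 : 0 ≤ K := by linarith
    have hKN1 : 1 ≤ K ^ (N + 1) := one_le_pow₀ hK
    calc K ^ (N + 1) - 1 = K * (K ^ N - 1) + (K - 1) := by ring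
      _ ≤ K * ((N : ℝ) * (K - 1) * K ^ N) + (K - 1) * K ^ (N + 1) :=
          add_le_add (mul_le_mul_of_nonneg_left ih hK0) (le_mul_of_one_le_right (by linarith) hKN1)
      _ = ((N + 1 : ℕ) : ℝ) * (K - 1) * K ^ (N + 1) := by push_cast; ring

variable {d : ℕ} (L : ℕ) [NeZero L] (m : Fin d → ℕ) [∀ i, NeZero (m i)] (n : ℕ) (hL : 1 ≤ L)
  {𝔸 : Type*} [NormedRing 𝔸] [NormedAlgebra ℂ 𝔸] [CompleteSpace 𝔸] [NormOneClass 𝔸]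
  {W : Type*} [NormedAddCommGroup W] [InnerProductSpace ℂ W] [FiniteDimensional ℂ W] (φ : W ≃ₗ[ℂ] 𝔸) {c₀ c₁ : ℝ} [Fact (0 < c₀)] [Fact (0 < c₁)]

section Assembled

variable [StarRing 𝔸] [NormedStarGroup 𝔸] [StarModule ℂ 𝔸]

set_option maxHeartbeats 1600000 in
/-- **THM 3.4 ∕ (3.86) ∕ (3.126) FOR PRINT's k-TH-STEP OPERATOR AT A FIXED LATTICE, FIRST ORDER BETWEEN TWO SMALL BACKGROUNDS: `‖G₁(U) − G₁(U′)‖ ≤ C₁·δ`,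
`‖H₁(U) − H₁(U′)‖ ≤ C₂·δ`** for the chain's `G₁(V) = G1LatticeK hpos` and `H₁(V) = H1LatticeK hpos hQ` at `Δ₁ := hessOp φ η V τ`, `Q := QkW … V …`
(ANY positivity ∕ surjectivity witnesses at `U` and at `U′`), at every pair of backgrounds with their tower data (profiles FIXED before `∃`), bonds and
level averages `U1`-valued, `ε`-small (`ε ≤ ε₇`), `δ`-close, `hRS`, `hRS′` — (Q2)₂'s proof one storey up: `δ_Δ = C_Δ·δ` ((Q1)₂-k §2),
`δ_Q = C_{Q,2}·δ` (`norm_QkW_sub_QkW_le`), the coercivity `γ₁` (min over the two profiles) and operator bound `MT` of `Δ_a^{(k)}` at both backgrounds,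
the explicit flat modulus of `Q_k(1)†` halved at both. [cite: Balaban1985BackgroundPropagators, Thm 3.4 p.400, (3.86) p.407, (3.126) p.420, Thm 3.11 p.416, (3.26) p.395; Balaban1985Variational, (45) p.285] -/
theorem exists_lipschitz_G1k_H1k_twoBackgrounds {η : ℝ} (hη : η ≠ 0) {a : ℝ} (ha : 0 < a) {Mφ Mφ' : ℝ} (hMφ : 0 ≤ Mφ) (hMφ' : 0 ≤ Mφ')
    (hφ : ∀ w, ‖φ w‖ ≤ Mφ * ‖w‖) (hφ' : ∀ X, ‖φ.symm X‖ ≤ Mφ' * ‖X‖) (τ : 𝔸 →ₗ[ℂ] ℂ) {Cτ : ℝ} (hτ : ∀ X, ‖τ X‖ ≤ Cτ * ‖X‖) (hCτ : 0 ≤ Cτ)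
    (α α' : ℕ → ℝ) (hα1 : ∀ j, α j ≤ 1 / 64) (hα1' : ∀ j, α' j ≤ 1 / 64) :
    ∃ C₁ C₂ ε₇ : ℝ, 0 < C₁ ∧ 0 < C₂ ∧ 0 < ε₇ ∧ ∀ (U U' : Bond d (towerP L m (n + 1)) → 𝔸ˣ)
      (hU1 : ∀ (j : ℕ) (x : B7Prop1Explicit.Site d) (κ : Fin d), perCfg (towerP L m (j + 1)) (UlevOf L m (n + 1) U j) x κ ∈ U1 𝔸)
      (hreg : ∀ (j : ℕ) (y : TSite d (towerP L m j)) (κ : Fin d) (r : Fin d → Fin L),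
        ‖((Wcx L (perCfg (towerP L m (j + 1)) (UlevOf L m (n + 1) U j)) (cornerSite L y) κ (boxVec L r) : 𝔸ˣ) : 𝔸) - 1‖ ≤ α j)
      (hα2 : ∀ j, 50 * (d + 1) * α j ≤ 1) (hα128 : ∀ j, α j ≤ 1 / 128)
      (hU1' : ∀ (j : ℕ) (x : B7Prop1Explicit.Site d) (κ : Fin d), perCfg (towerP L m (j + 1)) (UlevOf L m (n + 1) U' j) x κ ∈ U1 𝔸)
      (hreg' : ∀ (j : ℕ) (y : TSite d (towerP L m j)) (κ : Fin d) (r : Fin d → Fin L),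
        ‖((Wcx L (perCfg (towerP L m (j + 1)) (UlevOf L m (n + 1) U' j)) (cornerSite L y) κ (boxVec L r) : 𝔸ˣ) : 𝔸) - 1‖ ≤ α' j)
      (hα2' : ∀ j, 50 * (d + 1) * α' j ≤ 1) (hα128' : ∀ j, α' j ≤ 1 / 128)
      {ε δ : ℝ}, 0 ≤ ε → ε ≤ ε₇ → 0 ≤ δ →
      (∀ b, U b ∈ U1 𝔸) → (∀ b, U' b ∈ U1 𝔸) → (∀ b, ‖(U b : 𝔸) - 1‖ ≤ ε) → (∀ b, ‖(U' b : 𝔸) - 1‖ ≤ ε) →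
      (∀ b, ‖(U b : 𝔸) - (U' b : 𝔸)‖ ≤ δ) →
      (∀ (b : Bond d (towerP L m (n + 1))) (v u : W), ⟪adTransportW φ U b v, u⟫_ℂ = ⟪v, adTransportW φ (fun b => (U b)⁻¹) b u⟫_ℂ) →
      (∀ (b : Bond d (towerP L m (n + 1))) (v u : W), ⟪adTransportW φ U' b v, u⟫_ℂ = ⟪v, adTransportW φ (fun b => (U' b)⁻¹) b u⟫_ℂ) →
      (∀ (j : ℕ) (b : Bond d (towerP L m (j + 1))), UlevOf L m (n + 1) U j b ∈ U1 𝔸) →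
      (∀ (j : ℕ) (b : Bond d (towerP L m (j + 1))), UlevOf L m (n + 1) U' j b ∈ U1 𝔸) →
      (∀ (j : ℕ) (b : Bond d (towerP L m (j + 1))), ‖((UlevOf L m (n + 1) U j b : 𝔸ˣ) : 𝔸) - 1‖ ≤ ε) →
      (∀ (j : ℕ) (b : Bond d (towerP L m (j + 1))), ‖((UlevOf L m (n + 1) U' j b : 𝔸ˣ) : 𝔸) - 1‖ ≤ ε) →
      (∀ (j : ℕ) (b : Bond d (towerP L m (j + 1))),
        ‖((UlevOf L m (n + 1) U j b : 𝔸ˣ) : 𝔸) - ((UlevOf L m (n + 1) U' j b : 𝔸ˣ) : 𝔸)‖ ≤ δ) →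
      ∀ (hpos : ∀ x : BondL2K ℂ d (towerP L m (n + 1)) c₀ W, x ≠ 0 →
          0 < RCLike.re ⟪x, laplaceAk L m n φ η U hL α hα1 hU1 hreg τ (c₀ := c₀) (c₁ := c₁) a x⟫_ℂ)
        (hQ : Function.Surjective (QkW L m n φ U hL α hα1 hU1 hreg (c₀ := c₀) (c₁ := c₁)))
        (hpos' : ∀ x : BondL2K ℂ d (towerP L m (n + 1)) c₀ W, x ≠ 0 →
          0 < RCLike.re ⟪x, laplaceAk L m n φ η U' hL α' hα1' hU1' hreg' τ (c₀ := c₀) (c₁ := c₁) a x⟫_ℂ)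
        (hQ' : Function.Surjective (QkW L m n φ U' hL α' hα1' hU1' hreg' (c₀ := c₀) (c₁ := c₁))),
      (∀ z : BondL2K ℂ d (towerP L m (n + 1)) c₀ W,
        ‖G1LatticeK (Δ₁ := hessOp φ η U τ) (Q := QkW L m n φ U hL α hα1 hU1 hreg (c₀ := c₀) (c₁ := c₁)) hpos z -
          G1LatticeK (Δ₁ := hessOp φ η U' τ) (Q := QkW L m n φ U' hL α' hα1' hU1' hreg' (c₀ := c₀) (c₁ := c₁)) hpos' z‖ ≤ C₁ * δ * ‖z‖) ∧
      (∀ b : BondL2K ℂ d m c₁ W,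
        ‖H1LatticeK (Δ₁ := hessOp φ η U τ) (Q := QkW L m n φ U hL α hα1 hU1 hreg (c₀ := c₀) (c₁ := c₁)) hpos hQ b -
          H1LatticeK (Δ₁ := hessOp φ η U' τ) (Q := QkW L m n φ U' hL α' hα1' hU1' hreg' (c₀ := c₀) (c₁ := c₁)) hpos' hQ' b‖ ≤ C₂ * δ * ‖b‖) := by
  have hc₀ : 0 < c₀ := Fact.out
  have hL0 : (0 : ℝ) < L := by exact_mod_cast hL
  -- the uniform coercivity of `Δ_a^{(k)}(V)` on the small ball, for the two tower profiles (sections-free, NE9 leaf-02's append)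
  obtain ⟨γa, ε₃a, hγa, hε₃a, Hca⟩ :=
    exists_coercive_laplaceAk_of_small_field' L m n hL φ (c₀ := c₀) (c₁ := c₁) α hα1 hη ha hMφ hMφ' hφ hφ' τ hτ hCτ
  obtain ⟨γb, ε₃b, hγb, hε₃b, Hcb⟩ :=
    exists_coercive_laplaceAk_of_small_field' L m n hL φ (c₀ := c₀) (c₁ := c₁) α' hα1' hη ha hMφ hMφ' hφ hφ' τ hτ hCτ
  obtain ⟨γ₁, hγ₁def⟩ : ∃ γ₁ : ℝ, γ₁ = min γa γb := ⟨_, rfl⟩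
  have hγ₁ : 0 < γ₁ := by rw [hγ₁def]; exact lt_min hγa hγb
  obtain ⟨ε₃, hε₃def⟩ : ∃ ε₃ : ℝ, ε₃ = min ε₃a ε₃b := ⟨_, rfl⟩
  have hε₃ : 0 < ε₃ := by rw [hε₃def]; exact lt_min hε₃a hε₃b
  -- (Q1)₂-k §2: `δ_Δ = C_Δ·δ`
  obtain ⟨CΔ, ε₆, hCΔ, hε₆, HΔ⟩ :=
    exists_laplaceAk_sub_laplaceAk_le L m n hL φ (c₀ := c₀) (c₁ := c₁) hη a hMφ hMφ' hφ hφ' τ hτ hCτ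
  -- the flat tower averaging: operator norm `MQ1` and the explicit modulus `μQ1` of `Q_k(1)†` (the owner's INTENT-10)
  obtain ⟨MQ1, hMQ1def⟩ : ∃ MQ1 : ℝ, MQ1 = ‖LinearMap.toContinuousLinearMap
    (QkW L m n φ (fun _ : Bond d (towerP L m (n + 1)) => (1 : 𝔸ˣ)) hL (fun _ => 0) (fun _ => by norm_num) (perCfg_UlevOf_one_mem_U1 L m (n + 1)) (norm_Wcx_UlevOf_one_sub_one_le L m (n + 1) (fun _ => 0) (fun _ => le_rfl)) (c₀ := c₀) (c₁ := c₁))‖ := ⟨_, rfl⟩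
  have hMQ1 : 0 ≤ MQ1 := by rw [hMQ1def]; positivity
  have hQ1 : ∀ x : BondL2K ℂ d (towerP L m (n + 1)) c₀ W,
      ‖QkW L m n φ (fun _ : Bond d (towerP L m (n + 1)) => (1 : 𝔸ˣ)) hL (fun _ => 0) (fun _ => by norm_num) (perCfg_UlevOf_one_mem_U1 L m (n + 1)) (norm_Wcx_UlevOf_one_sub_one_le L m (n + 1) (fun _ => 0) (fun _ => le_rfl)) (c₀ := c₀) (c₁ := c₁) x‖ ≤ MQ1 * ‖x‖ :=
    fun x => by
      rw [hMQ1def]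
      exact (LinearMap.toContinuousLinearMap
        (QkW L m n φ (fun _ : Bond d (towerP L m (n + 1)) => (1 : 𝔸ˣ)) hL (fun _ => 0) (fun _ => by norm_num) (perCfg_UlevOf_one_mem_U1 L m (n + 1)) (norm_Wcx_UlevOf_one_sub_one_le L m (n + 1) (fun _ => 0) (fun _ => le_rfl)) (c₀ := c₀) (c₁ := c₁))).le_opNorm x
  obtain ⟨μQ1, hμQ1, hQ1adj⟩ := exists_modulus_adjoint_QkW_one L m hL φ (c₀ := c₀) (c₁ := c₁) n
  -- the constants
  obtain ⟨KR, hKRdef⟩ : ∃ KR : ℝ, KR = 2 * Mφ * Mφ' := ⟨_, rfl⟩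
  have hKR : 0 ≤ KR := by rw [hKRdef]; positivity
  obtain ⟨N, hNdef⟩ : ∃ N : ℝ, N = ((2 * (d * L) + L + L : ℕ) : ℝ) := ⟨_, rfl⟩
  have hN1 : (1 : ℝ) ≤ N := by
    have : 1 ≤ 2 * (d * L) + L + L := by omega
    rw [hNdef]; exact_mod_cast this
  have hN : 0 < N := by linarith
  have h2n : (0 : ℝ) ≤ 2 ^ (n + 1) - 1 := sub_nonneg.2 (one_le_pow₀ (by norm_num))
  obtain ⟨CQ, hCQdef⟩ : ∃ CQ : ℝ, CQ = Mφ' * Mφ * Real.sqrt (c₁ * Fintype.card (Bond d m) / c₀) *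
      ((2 ^ (n + 1) - 1) * (102 * ((d : ℝ) + 1) ^ 2 * L)) := ⟨_, rfl⟩
  have hCQ : 0 ≤ CQ := by rw [hCQdef]; positivity
  obtain ⟨CQ₂, hCQ₂def⟩ : ∃ CQ₂ : ℝ, CQ₂ = Mφ' * Mφ * Real.sqrt (c₁ * Fintype.card (Bond d m) / c₀) *
      (((n : ℝ) + 1) * 2 ^ (n + 1) * (75497472 * ((d : ℝ) + 1) * N)) := ⟨_, rfl⟩
  have hCQ₂ : 0 ≤ CQ₂ := by rw [hCQ₂def]; positivity
  obtain ⟨Cρ, hCρdef⟩ : ∃ Cρ : ℝ, Cρ = ((n : ℝ) + 1) * (d * (L - 1) : ℕ) * 2 ^ (d * (L - 1) * (n + 2)) * (Real.sqrt c₀)⁻¹ := ⟨_, rfl⟩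
  have hCρ : 0 ≤ Cρ := by rw [hCρdef]; positivity
  obtain ⟨MT, hMTdef⟩ : ∃ MT : ℝ, MT = 64 * d * ‖((η : ℂ))⁻¹‖ ^ 2 + 16 * ‖((η : ℂ))⁻¹‖ ^ 2 * d +
      32 * d * Cτ * Mφ ^ 2 * (|η| ^ d / c₀) * (‖((η : ℂ))⁻¹‖ ^ 2 * (4 * 1)) + (MQ1 + CQ) * (|a| * (MQ1 + CQ)) + 1 := ⟨_, rfl⟩
  have hMT0 : 0 < MT := by rw [hMTdef]; positivity
  obtain ⟨κ, hκdef⟩ : ∃ κ : ℝ, κ = γ₁ * (μQ1 / 2) ^ 2 / MT ^ 2 := ⟨_, rfl⟩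
  have hκ : 0 < κ := by rw [hκdef]; positivity
  refine ⟨γ₁⁻¹ * CΔ * γ₁⁻¹,
    γ₁⁻¹ * CΔ * γ₁⁻¹ * ((MQ1 + CQ) * κ⁻¹) + γ₁⁻¹ * (CQ₂ * κ⁻¹) +
      γ₁⁻¹ * ((MQ1 + CQ) * (κ⁻¹ * (CQ₂ * (γ₁⁻¹ * (MQ1 + CQ)) + (MQ1 + CQ) * (γ₁⁻¹ * CΔ * γ₁⁻¹ * (MQ1 + CQ)) + (MQ1 + CQ) * (γ₁⁻¹ * CQ₂)) * κ⁻¹)) + 1,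
    min (ε₃ / (Cρ * KR + CQ + 2)) (min (1 / (KR + 1)) (min 1 (min (μQ1 / (2 * CQ + 1)) (min ε₆ (1 / (24576 * N)))))),
    by positivity, by positivity, by positivity, ?_⟩
  intro U U' hU1 hreg hα2 hα128 hU1' hreg' hα2' hα128' ε δ hε hε₇ hδ hUb hU'b hUε hU'ε hUU' hRS hRS' hLb hL'b hLε hL'ε hLL'
    hpos hQs hpos' hQs'
  have hεε₃' : ε ≤ ε₃ / (Cρ * KR + CQ + 2) := hε₇.trans (min_le_left _ _)
  have hε1' : ε ≤ 1 / (KR + 1) := hε₇.trans ((min_le_right _ _).trans (min_le_left _ _))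
  have hε1 : ε ≤ 1 := hε₇.trans ((min_le_right _ _).trans ((min_le_right _ _).trans (min_le_left _ _)))
  have hεμ : ε ≤ μQ1 / (2 * CQ + 1) := hε₇.trans ((min_le_right _ _).trans ((min_le_right _ _).trans ((min_le_right _ _).trans (min_le_left _ _))))
  have hεε₆ : ε ≤ ε₆ :=
    hε₇.trans ((min_le_right _ _).trans ((min_le_right _ _).trans ((min_le_right _ _).trans ((min_le_right _ _).trans (min_le_left _ _)))))
  have hεN' : ε ≤ 1 / (24576 * N) :=
    hε₇.trans ((min_le_right _ _).trans ((min_le_right _ _).trans ((min_le_right _ _).trans ((min_le_right _ _).trans (min_le_right _ _)))))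
  have hεR1 : 2 * Mφ * Mφ' * ε ≤ 1 := by
    rw [← hKRdef]
    refine (mul_le_mul_of_nonneg_left hε1' hKR).trans ?_
    rw [mul_one_div, div_le_one (by positivity)]; linarith
  have hKRε : KR * ε ≤ 1 := by rw [hKRdef]; exact hεR1
  have hδQ : CQ * ε ≤ μQ1 / 2 := by
    have h1 : CQ * ε ≤ CQ * (μQ1 / (2 * CQ + 1)) := mul_le_mul_of_nonneg_left hεμ hCQ
    have h2 : CQ * (μQ1 / (2 * CQ + 1)) ≤ μQ1 / 2 := by
      rw [mul_div_assoc', div_le_div_iff₀ (by positivity) (by norm_num)]; nlinarith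
    exact h1.trans h2
  -- the effective distance `δ₀ = δ ∧ 2ε` for the two-background `δ_Q`
  obtain ⟨δ₀, hδ₀def⟩ : ∃ δ₀ : ℝ, δ₀ = min δ (2 * ε) := ⟨_, rfl⟩
  have hδ₀ : 0 ≤ δ₀ := by rw [hδ₀def]; exact le_min hδ (by positivity)
  have hδ₀δ : δ₀ ≤ δ := by rw [hδ₀def]; exact min_le_left _ _
  have hδ₀N : δ₀ ≤ 1 / (12288 * ((2 * (d * L) + L + L : ℕ) : ℝ)) := by
    rw [← hNdef]
    refine (show δ₀ ≤ 2 * ε by rw [hδ₀def]; exact min_le_right _ _).trans ?_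
    have := mul_le_mul_of_nonneg_left hεN' (by norm_num : (0 : ℝ) ≤ 2)
    refine this.trans (le_of_eq ?_)
    field_simp; norm_num
  have hL'L₀ : ∀ (j : ℕ) (b : Bond d (towerP L m (j + 1))),
      ‖((UlevOf L m (n + 1) U' j b : 𝔸ˣ) : 𝔸) - ((UlevOf L m (n + 1) U j b : 𝔸ˣ) : 𝔸)‖ ≤ δ₀ := fun j b => by
    rw [hδ₀def, norm_sub_rev]
    refine le_min (hLL' j b) ?_
    calc ‖((UlevOf L m (n + 1) U j b : 𝔸ˣ) : 𝔸) - ((UlevOf L m (n + 1) U' j b : 𝔸ˣ) : 𝔸)‖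
        = ‖(((UlevOf L m (n + 1) U j b : 𝔸ˣ) : 𝔸) - 1) - (((UlevOf L m (n + 1) U' j b : 𝔸ˣ) : 𝔸) - 1)‖ := by rw [sub_sub_sub_cancel_right]
      _ ≤ ‖((UlevOf L m (n + 1) U j b : 𝔸ˣ) : 𝔸) - 1‖ + ‖((UlevOf L m (n + 1) U' j b : 𝔸ˣ) : 𝔸) - 1‖ := norm_sub_le _ _
      _ ≤ 2 * ε := by linarith [hLε j b, hL'ε j b]
  -- `Q(V)` against `Q(1)` (flat `δ_Q`), operator bounds, adjoint moduli — at `U` and at `U′`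
  have hQdiff : ∀ (V : Bond d (towerP L m (n + 1)) → 𝔸ˣ) (β : ℕ → ℝ) (hβ : ∀ j, β j ≤ 1 / 64)
      (hV1 : ∀ (j : ℕ) (x : B7Prop1Explicit.Site d) (κ : Fin d), perCfg (towerP L m (j + 1)) (UlevOf L m (n + 1) V j) x κ ∈ U1 𝔸)
      (hregV : ∀ (j : ℕ) (y : TSite d (towerP L m j)) (κ : Fin d) (r : Fin d → Fin L),
        ‖((Wcx L (perCfg (towerP L m (j + 1)) (UlevOf L m (n + 1) V j)) (cornerSite L y) κ (boxVec L r) : 𝔸ˣ) : 𝔸) - 1‖ ≤ β j)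
      (hβ2 : ∀ j, 50 * (d + 1) * β j ≤ 1),
      (∀ (j : ℕ) (b : Bond d (towerP L m (j + 1))), ‖((UlevOf L m (n + 1) V j b : 𝔸ˣ) : 𝔸) - 1‖ ≤ ε) →
      ∀ x : BondL2K ℂ d (towerP L m (n + 1)) c₀ W, ‖QkW L m n φ V hL β hβ hV1 hregV (c₁ := c₁) x -
      QkW L m n φ (fun _ : Bond d (towerP L m (n + 1)) => (1 : 𝔸ˣ)) hL (fun _ => 0) (fun _ => by norm_num) (perCfg_UlevOf_one_mem_U1 L m (n + 1)) (norm_Wcx_UlevOf_one_sub_one_le L m (n + 1) (fun _ => 0) (fun _ => le_rfl)) (c₁ := c₁) x‖ ≤ CQ * ε * ‖x‖ := by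
    intro V β hβ hV1 hregV hβ2 hVLε x
    refine (norm_QkW_sub_flat_le L m n hL φ hMφ hMφ' hφ hφ' V β hβ hV1 hregV hβ2 hε hVLε (c₁ := c₁) x).trans (le_of_eq ?_)
    rw [hCQdef]; ring
  have hQV : ∀ (V : Bond d (towerP L m (n + 1)) → 𝔸ˣ) (β : ℕ → ℝ) (hβ : ∀ j, β j ≤ 1 / 64)
      (hV1 : ∀ (j : ℕ) (x : B7Prop1Explicit.Site d) (κ : Fin d), perCfg (towerP L m (j + 1)) (UlevOf L m (n + 1) V j) x κ ∈ U1 𝔸)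
      (hregV : ∀ (j : ℕ) (y : TSite d (towerP L m j)) (κ : Fin d) (r : Fin d → Fin L),
        ‖((Wcx L (perCfg (towerP L m (j + 1)) (UlevOf L m (n + 1) V j)) (cornerSite L y) κ (boxVec L r) : 𝔸ˣ) : 𝔸) - 1‖ ≤ β j)
      (hβ2 : ∀ j, 50 * (d + 1) * β j ≤ 1),
      (∀ (j : ℕ) (b : Bond d (towerP L m (j + 1))), ‖((UlevOf L m (n + 1) V j b : 𝔸ˣ) : 𝔸) - 1‖ ≤ ε) → ∀ x : BondL2K ℂ d (towerP L m (n + 1)) c₀ W, ‖QkW L m n φ V hL β hβ hV1 hregV (c₀ := c₀) (c₁ := c₁) x‖ ≤ (MQ1 + CQ) * ‖x‖ := by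
    intro V β hβ hV1 hregV hβ2 hVLε x
    have h1 := hQ1 x
    have h2 := hQdiff V β hβ hV1 hregV hβ2 hVLε x
    have h3 := norm_le_insert' (QkW L m n φ V hL β hβ hV1 hregV (c₀ := c₀) (c₁ := c₁) x)
      (QkW L m n φ (fun _ : Bond d (towerP L m (n + 1)) => (1 : 𝔸ˣ)) hL (fun _ => 0) (fun _ => by norm_num) (perCfg_UlevOf_one_mem_U1 L m (n + 1)) (norm_Wcx_UlevOf_one_sub_one_le L m (n + 1) (fun _ => 0) (fun _ => le_rfl)) (c₀ := c₀) (c₁ := c₁) x)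
    have h4 : CQ * ε * ‖x‖ ≤ CQ * ‖x‖ := mul_le_mul_of_nonneg_right (mul_le_of_le_one_right hCQ hε1) (norm_nonneg x)
    linarith
  have hQVadj : ∀ (V : Bond d (towerP L m (n + 1)) → 𝔸ˣ) (β : ℕ → ℝ) (hβ : ∀ j, β j ≤ 1 / 64)
      (hV1 : ∀ (j : ℕ) (x : B7Prop1Explicit.Site d) (κ : Fin d), perCfg (towerP L m (j + 1)) (UlevOf L m (n + 1) V j) x κ ∈ U1 𝔸)
      (hregV : ∀ (j : ℕ) (y : TSite d (towerP L m j)) (κ : Fin d) (r : Fin d → Fin L),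
        ‖((Wcx L (perCfg (towerP L m (j + 1)) (UlevOf L m (n + 1) V j)) (cornerSite L y) κ (boxVec L r) : 𝔸ˣ) : 𝔸) - 1‖ ≤ β j)
      (hβ2 : ∀ j, 50 * (d + 1) * β j ≤ 1),
      (∀ (j : ℕ) (b : Bond d (towerP L m (j + 1))), ‖((UlevOf L m (n + 1) V j b : 𝔸ˣ) : 𝔸) - 1‖ ≤ ε) → ∀ y : BondL2K ℂ d m c₁ W,
      μQ1 / 2 * ‖y‖ ≤ ‖LinearMap.adjoint (QkW L m n φ V hL β hβ hV1 hregV (c₀ := c₀) (c₁ := c₁)) y‖ := by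
    intro V β hβ hV1 hregV hβ2 hVLε y
    have h1 := hQ1adj y
    have h2 : ‖LinearMap.adjoint (QkW L m n φ V hL β hβ hV1 hregV (c₀ := c₀) (c₁ := c₁) -
        QkW L m n φ (fun _ : Bond d (towerP L m (n + 1)) => (1 : 𝔸ˣ)) hL (fun _ => 0) (fun _ => by norm_num) (perCfg_UlevOf_one_mem_U1 L m (n + 1)) (norm_Wcx_UlevOf_one_sub_one_le L m (n + 1) (fun _ => 0) (fun _ => le_rfl)) (c₀ := c₀) (c₁ := c₁)) y‖ ≤ CQ * ε * ‖y‖ :=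
      norm_adjoint_apply_le _ (by positivity) (fun x => by rw [LinearMap.sub_apply]; exact hQdiff V β hβ hV1 hregV hβ2 hVLε x) y
    rw [map_sub, LinearMap.sub_apply] at h2
    have h3 := norm_le_insert (LinearMap.adjoint (QkW L m n φ V hL β hβ hV1 hregV (c₀ := c₀) (c₁ := c₁)) y)
      (LinearMap.adjoint (QkW L m n φ (fun _ : Bond d (towerP L m (n + 1)) => (1 : 𝔸ˣ)) hL (fun _ => 0) (fun _ => by norm_num) (perCfg_UlevOf_one_mem_U1 L m (n + 1)) (norm_Wcx_UlevOf_one_sub_one_le L m (n + 1) (fun _ => 0) (fun _ => le_rfl)) (c₀ := c₀) (c₁ := c₁)) y)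
    have h4 : CQ * ε * ‖y‖ ≤ μQ1 / 2 * ‖y‖ := mul_le_mul_of_nonneg_right hδQ (norm_nonneg _)
    linarith
  have hQU := hQV U α hα1 hU1 hreg hα2 hLε
  have hQU' := hQV U' α' hα1' hU1' hreg' hα2' hL'ε
  have hQUadj := hQVadj U α hα1 hU1 hreg hα2 hLε
  have hQU'adj := hQVadj U' α' hα1' hU1' hreg' hα2' hL'ε
  -- the two-background `δ_Q` ((δ_Q)₂ §6), `U` as the base: `‖Q(U′)x − Q(U)x‖ ≤ C_Q·δ·‖x‖`
  have hQdiff₂ : ∀ x : BondL2K ℂ d (towerP L m (n + 1)) c₀ W,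
      ‖QkW L m n φ U' hL α' hα1' hU1' hreg' (c₁ := c₁) x - QkW L m n φ U hL α hα1 hU1 hreg (c₁ := c₁) x‖ ≤ CQ₂ * δ * ‖x‖ := fun x => by
    refine (norm_QkW_sub_QkW_le L m n hL φ hMφ hMφ' hφ hφ' U' U α' hα1' hU1' hreg' hα2' α hα1 hU1 hreg hα2 hα128 hLb hδ₀ hδ₀N hL'L₀
      (c₁ := c₁) x).trans ?_
    have h1 : Mφ' * Mφ * Real.sqrt (c₁ * Fintype.card (Bond d m) / c₀) *
        (((n : ℝ) + 1) * 2 ^ (n + 1) * (75497472 * ((d : ℝ) + 1) * ((2 * (d * L) + L + L : ℕ) : ℝ) * δ₀)) * ‖x‖ = CQ₂ * δ₀ * ‖x‖ := by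
      rw [hCQ₂def, hNdef]; ring
    rw [h1]
    exact mul_le_mul_of_nonneg_right (mul_le_mul_of_nonneg_left hδ₀δ hCQ₂) (norm_nonneg _)
  -- the operator bound `MT` and the coercivity `γ₁` of `Δ_a`, at `U` and at `U′`, in the `laplaceAK` form
  have hMTV : ∀ (V : Bond d (towerP L m (n + 1)) → 𝔸ˣ) (β : ℕ → ℝ) (hβ : ∀ j, β j ≤ 1 / 64)
      (hV1 : ∀ (j : ℕ) (x : B7Prop1Explicit.Site d) (κ : Fin d), perCfg (towerP L m (j + 1)) (UlevOf L m (n + 1) V j) x κ ∈ U1 𝔸)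
      (hregV : ∀ (j : ℕ) (y : TSite d (towerP L m j)) (κ : Fin d) (r : Fin d → Fin L),
        ‖((Wcx L (perCfg (towerP L m (j + 1)) (UlevOf L m (n + 1) V j)) (cornerSite L y) κ (boxVec L r) : 𝔸ˣ) : 𝔸) - 1‖ ≤ β j)
      (hβ2 : ∀ j, 50 * (d + 1) * β j ≤ 1),
      (∀ (j : ℕ) (b : Bond d (towerP L m (j + 1))), ‖((UlevOf L m (n + 1) V j b : 𝔸ˣ) : 𝔸) - 1‖ ≤ ε) →
      (∀ b, V b ∈ U1 𝔸) → (∀ b, ‖(V b : 𝔸) - 1‖ ≤ ε) →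
      (∀ (b : Bond d (towerP L m (n + 1))) (v u : W), ⟪adTransportW φ V b v, u⟫_ℂ = ⟪v, adTransportW φ (fun b => (V b)⁻¹) b u⟫_ℂ) →
      ∀ x : BondL2K ℂ d (towerP L m (n + 1)) c₀ W,
      ‖laplaceAK (hessOp φ η V τ) (covDerivL2K ℂ c₀ ((η : ℂ))⁻¹ (adTransportW φ V)) (RofUk L m n φ η V)
        (covDivL2K ℂ c₀ ((η : ℂ))⁻¹ (adTransportW φ fun b => (V b)⁻¹)) (QkW L m n φ V hL β hβ hV1 hregV (c₀ := c₀) (c₁ := c₁))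
        (LinearMap.adjoint (QkW L m n φ V hL β hβ hV1 hregV (c₀ := c₀) (c₁ := c₁))) (RCLike.ofReal a) x‖ ≤ MT * ‖x‖ := by
    intro V β hβ hV1 hregV hβ2 hVLε hVb hVε hRSV x
    have hMTU := norm_laplaceAk_le L m n hL φ (c₀ := c₀) (c₁ := c₁) β hβ hMφ hMφ' hφ hφ' τ hτ hCτ (η := η) a V hV1 hregV hVb hε hεR1 hVε
      hRSV (by positivity) (hQV V β hβ hV1 hregV hβ2 hVLε)
    refine (hMTU x).trans (mul_le_mul_of_nonneg_right ?_ (norm_nonneg _))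
    rw [hMTdef]
    have h1 : 32 * d * Cτ * Mφ ^ 2 * (|η| ^ d / c₀) * (‖((η : ℂ))⁻¹‖ ^ 2 * (4 * ε)) ≤
        32 * d * Cτ * Mφ ^ 2 * (|η| ^ d / c₀) * (‖((η : ℂ))⁻¹‖ ^ 2 * (4 * 1)) := by gcongr
    linarith
  have hMT := hMTV U α hα1 hU1 hreg hα2 hLε hUb hUε hRS
  have hMT' := hMTV U' α' hα1' hU1' hreg' hα2' hL'ε hU'b hU'ε hRS'
  -- the `ρ′_k`-letters of the two backgrounds against the flat tower (the owner's INTENT-5), majorised linearly in `ε`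
  have hK1 : (1 : ℝ) ≤ (1 + KR * ε) ^ (d * (L - 1)) := one_le_pow₀ (by linarith [mul_nonneg hKR hε])
  have hmaj1 : (((1 + KR * ε) ^ (d * (L - 1))) ^ (n + 1) - 1) * (Real.sqrt c₀)⁻¹ ≤ Cρ * (KR * ε) := by
    rw [hCρdef]
    have hεR0 : 0 ≤ KR * ε := mul_nonneg hKR hε
    have h1 := pow_sub_one_le_mul_pow hK1 (n + 1)
    have h2 : (1 + KR * ε) ^ (d * (L - 1)) - 1 ≤ (d * (L - 1) : ℕ) * (KR * ε) * (1 + KR * ε) ^ (d * (L - 1)) :=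
      B9Eq319QprimeLipschitz.rho_le L (d := d) hεR0
    have h3 : ((1 + KR * ε) ^ (d * (L - 1))) ^ (n + 1) * (1 + KR * ε) ^ (d * (L - 1)) ≤ (2 : ℝ) ^ (d * (L - 1) * (n + 2)) := by
      rw [← pow_succ, ← pow_mul]
      exact pow_le_pow_left₀ (by positivity) (by linarith) _
    have h4 : ((1 + KR * ε) ^ (d * (L - 1))) ^ (n + 1) - 1 ≤
        ((n : ℝ) + 1) * (d * (L - 1) : ℕ) * 2 ^ (d * (L - 1) * (n + 2)) * (KR * ε) := by
      have hA : 0 ≤ ((n : ℝ) + 1) * ((d * (L - 1) : ℕ) * (KR * ε)) := by positivity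
      calc ((1 + KR * ε) ^ (d * (L - 1))) ^ (n + 1) - 1
          ≤ ((n + 1 : ℕ) : ℝ) * ((1 + KR * ε) ^ (d * (L - 1)) - 1) * ((1 + KR * ε) ^ (d * (L - 1))) ^ (n + 1) := h1
        _ ≤ ((n + 1 : ℕ) : ℝ) * ((d * (L - 1) : ℕ) * (KR * ε) * (1 + KR * ε) ^ (d * (L - 1))) * ((1 + KR * ε) ^ (d * (L - 1))) ^ (n + 1) := by
            gcongr
        _ = ((n : ℝ) + 1) * ((d * (L - 1) : ℕ) * (KR * ε)) * (((1 + KR * ε) ^ (d * (L - 1))) ^ (n + 1) * (1 + KR * ε) ^ (d * (L - 1))) := by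
            push_cast; ring
        _ ≤ ((n : ℝ) + 1) * ((d * (L - 1) : ℕ) * (KR * ε)) * (2 : ℝ) ^ (d * (L - 1) * (n + 2)) := mul_le_mul_of_nonneg_left h3 hA
        _ = ((n : ℝ) + 1) * (d * (L - 1) : ℕ) * 2 ^ (d * (L - 1) * (n + 2)) * (KR * ε) := by ring
    have hinv : 0 ≤ (Real.sqrt c₀)⁻¹ := by positivity
    calc (((1 + KR * ε) ^ (d * (L - 1))) ^ (n + 1) - 1) * (Real.sqrt c₀)⁻¹
        ≤ (((n : ℝ) + 1) * (d * (L - 1) : ℕ) * 2 ^ (d * (L - 1) * (n + 2)) * (KR * ε)) * (Real.sqrt c₀)⁻¹ :=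
          mul_le_mul_of_nonneg_right h4 hinv
      _ = ((n : ℝ) + 1) * (d * (L - 1) : ℕ) * 2 ^ (d * (L - 1) * (n + 2)) * (Real.sqrt c₀)⁻¹ * (KR * ε) := by ring
  have hρ'V : ∀ (V : Bond d (towerP L m (n + 1)) → 𝔸ˣ),
      (∀ (j : ℕ) (b : Bond d (towerP L m (j + 1))), UlevOf L m (n + 1) V j b ∈ U1 𝔸) →
      (∀ (j : ℕ) (b : Bond d (towerP L m (j + 1))), ‖((UlevOf L m (n + 1) V j b : 𝔸ˣ) : 𝔸) - 1‖ ≤ ε) →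
      ∀ l : SiteL2K ℂ d (towerP L m (n + 1)) c₀ W,
        ‖QprimeTowerW L m n φ V l - QprimeTowerW L m n φ (fun _ : Bond d (towerP L m (n + 1)) => (1 : 𝔸ˣ)) l‖ ≤ Cρ * (KR * ε) * ‖l‖ := by
    intro V hVLb hVLε l
    have h := norm_QprimeTowerW_sub_flat_le L m n φ hMφ hMφ' hφ hφ' V hε hVLε hVLb l
    have e : 2 * Mφ * Mφ' * ε = KR * ε := by rw [hKRdef]
    rw [e] at h
    refine h.trans ?_
    rw [← mul_assoc]
    exact mul_le_mul_of_nonneg_right hmaj1 (norm_nonneg _)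
  have hρ0 : 0 ≤ Cρ * (KR * ε) := by positivity
  have hCQε0 : 0 ≤ CQ * ε := by positivity
  -- the coercivity sum condition `ε + ρ′ + δ_Q ≤ ε₃ ≤ ε₃a, ε₃b`
  have hsum : ε + Cρ * (KR * ε) + CQ * ε ≤ ε₃ := by
    have h1 : ε + Cρ * (KR * ε) + CQ * ε = (Cρ * KR + CQ + 1) * ε := by ring
    rw [h1]
    have h2 : (Cρ * KR + CQ + 1) * ε ≤ (Cρ * KR + CQ + 2) * ε := by nlinarith
    have h3 : (Cρ * KR + CQ + 2) * ε ≤ ε₃ := by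
      have := mul_le_mul_of_nonneg_left hεε₃' (by positivity : (0 : ℝ) ≤ Cρ * KR + CQ + 2)
      rwa [mul_div_cancel₀ _ (by positivity : (Cρ * KR + CQ + 2) ≠ 0)] at this
    exact h2.trans h3
  have hsuma : ε + Cρ * (KR * ε) + CQ * ε ≤ ε₃a := hsum.trans (by rw [hε₃def]; exact min_le_left _ _)
  have hsumb : ε + Cρ * (KR * ε) + CQ * ε ≤ ε₃b := hsum.trans (by rw [hε₃def]; exact min_le_right _ _)
  have hcoer : ∀ x : BondL2K ℂ d (towerP L m (n + 1)) c₀ W, γ₁ * ‖x‖ ^ 2 ≤ RCLike.re ⟪x,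
      laplaceAK (hessOp φ η U τ) (covDerivL2K ℂ c₀ ((η : ℂ))⁻¹ (adTransportW φ U)) (RofUk L m n φ η U)
        (covDivL2K ℂ c₀ ((η : ℂ))⁻¹ (adTransportW φ fun b => (U b)⁻¹)) (QkW L m n φ U hL α hα1 hU1 hreg (c₀ := c₀) (c₁ := c₁))
        (LinearMap.adjoint (QkW L m n φ U hL α hα1 hU1 hreg (c₀ := c₀) (c₁ := c₁))) (RCLike.ofReal a) x⟫_ℂ := fun x => by
    have h := Hca U hU1 hreg hε hρ0 hCQε0 hsuma hUb hUε hRS (hρ'V U hLb hLε) (hQdiff U α hα1 hU1 hreg hα2 hLε) x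
    have hmin : γ₁ ≤ γa := by rw [hγ₁def]; exact min_le_left _ _
    exact le_trans (mul_le_mul_of_nonneg_right hmin (sq_nonneg _)) h
  have hcoer' : ∀ x : BondL2K ℂ d (towerP L m (n + 1)) c₀ W, γ₁ * ‖x‖ ^ 2 ≤ RCLike.re ⟪x,
      laplaceAK (hessOp φ η U' τ) (covDerivL2K ℂ c₀ ((η : ℂ))⁻¹ (adTransportW φ U')) (RofUk L m n φ η U')
        (covDivL2K ℂ c₀ ((η : ℂ))⁻¹ (adTransportW φ fun b => (U' b)⁻¹)) (QkW L m n φ U' hL α' hα1' hU1' hreg' (c₀ := c₀) (c₁ := c₁))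
        (LinearMap.adjoint (QkW L m n φ U' hL α' hα1' hU1' hreg' (c₀ := c₀) (c₁ := c₁))) (RCLike.ofReal a) x⟫_ℂ := fun x => by
    have h := Hcb U' hU1' hreg' hε hρ0 hCQε0 hsumb hU'b hU'ε hRS' (hρ'V U' hL'b hL'ε) (hQdiff U' α' hα1' hU1' hreg' hα2' hL'ε) x
    have hmin : γ₁ ≤ γb := by rw [hγ₁def]; exact min_le_right _ _
    exact le_trans (mul_le_mul_of_nonneg_right hmin (sq_nonneg _)) h
  have hposU : ∀ x : BondL2K ℂ d (towerP L m (n + 1)) c₀ W, x ≠ 0 → 0 < RCLike.re ⟪x,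
      laplaceAK (hessOp φ η U τ) (covDerivL2K ℂ c₀ ((η : ℂ))⁻¹ (adTransportW φ U)) (RofUk L m n φ η U)
        (covDivL2K ℂ c₀ ((η : ℂ))⁻¹ (adTransportW φ fun b => (U b)⁻¹)) (QkW L m n φ U hL α hα1 hU1 hreg (c₀ := c₀) (c₁ := c₁))
        (LinearMap.adjoint (QkW L m n φ U hL α hα1 hU1 hreg (c₀ := c₀) (c₁ := c₁))) (RCLike.ofReal a) x⟫_ℂ := hpos
  have hposU' : ∀ x : BondL2K ℂ d (towerP L m (n + 1)) c₀ W, x ≠ 0 → 0 < RCLike.re ⟪x,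
      laplaceAK (hessOp φ η U' τ) (covDerivL2K ℂ c₀ ((η : ℂ))⁻¹ (adTransportW φ U')) (RofUk L m n φ η U')
        (covDivL2K ℂ c₀ ((η : ℂ))⁻¹ (adTransportW φ fun b => (U' b)⁻¹)) (QkW L m n φ U' hL α' hα1' hU1' hreg' (c₀ := c₀) (c₁ := c₁))
        (LinearMap.adjoint (QkW L m n φ U' hL α' hα1' hU1' hreg' (c₀ := c₀) (c₁ := c₁))) (RCLike.ofReal a) x⟫_ℂ := hpos'
  -- `δ_Δ`: the data difference in the `laplaceAK` form (`U′` minus `U`)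
  have hδT : ∀ x : BondL2K ℂ d (towerP L m (n + 1)) c₀ W,
      ‖laplaceAK (hessOp φ η U' τ) (covDerivL2K ℂ c₀ ((η : ℂ))⁻¹ (adTransportW φ U')) (RofUk L m n φ η U')
          (covDivL2K ℂ c₀ ((η : ℂ))⁻¹ (adTransportW φ fun b => (U' b)⁻¹)) (QkW L m n φ U' hL α' hα1' hU1' hreg' (c₀ := c₀) (c₁ := c₁))
          (LinearMap.adjoint (QkW L m n φ U' hL α' hα1' hU1' hreg' (c₀ := c₀) (c₁ := c₁))) (RCLike.ofReal a) x -
        laplaceAK (hessOp φ η U τ) (covDerivL2K ℂ c₀ ((η : ℂ))⁻¹ (adTransportW φ U)) (RofUk L m n φ η U)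
          (covDivL2K ℂ c₀ ((η : ℂ))⁻¹ (adTransportW φ fun b => (U b)⁻¹)) (QkW L m n φ U hL α hα1 hU1 hreg (c₀ := c₀) (c₁ := c₁))
          (LinearMap.adjoint (QkW L m n φ U hL α hα1 hU1 hreg (c₀ := c₀) (c₁ := c₁))) (RCLike.ofReal a) x‖ ≤ CΔ * δ * ‖x‖ := fun x => by
    rw [norm_sub_rev]
    exact HΔ U U' α α' hα1 hU1 hreg hα2 hα1' hU1' hreg' hα2' hα128' hε hεε₆ hδ hUb hU'b hUε hU'ε hUU' hRS hRS' hLb hL'b hLε hL'ε hLL' x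
  have hμ2 : 0 < μQ1 / 2 := by positivity
  refine ⟨fun z => ?_, fun b => ?_⟩
  · have h := norm_G1K_sub_le (𝕜 := ℂ) (E := BondL2K ℂ d (towerP L m (n + 1)) c₀ W) (F := BondL2K ℂ d m c₁ W) (S := SiteL2K ℂ d (towerP L m (n + 1)) c₀ W)
      (Δ₁ := hessOp φ η U τ (c₀ := c₀)) (Δ₂ := hessOp φ η U' τ (c₀ := c₀))
      (D₁ := covDerivL2K ℂ c₀ ((η : ℂ))⁻¹ (adTransportW φ U)) (D₂ := covDerivL2K ℂ c₀ ((η : ℂ))⁻¹ (adTransportW φ U'))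
      (R₁ := RofUk L m n φ η U (c₀ := c₀)) (R₂ := RofUk L m n φ η U' (c₀ := c₀))
      (Ds₁ := covDivL2K ℂ c₀ ((η : ℂ))⁻¹ (adTransportW φ fun b => (U b)⁻¹))
      (Ds₂ := covDivL2K ℂ c₀ ((η : ℂ))⁻¹ (adTransportW φ fun b => (U' b)⁻¹))
      (Q₁ := QkW L m n φ U hL α hα1 hU1 hreg (c₀ := c₀) (c₁ := c₁))
      (Q₂ := QkW L m n φ U' hL α' hα1' hU1' hreg' (c₀ := c₀) (c₁ := c₁))
      (a := RCLike.ofReal a) (γ := γ₁) (δT := CΔ * δ) hγ₁ hcoer hcoer' hposU hposU' (by positivity) hδT z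
    have h' : ‖G1LatticeK (Δ₁ := hessOp φ η U τ) (Q := QkW L m n φ U hL α hα1 hU1 hreg (c₀ := c₀) (c₁ := c₁)) hpos z -
        G1LatticeK (Δ₁ := hessOp φ η U' τ) (Q := QkW L m n φ U' hL α' hα1' hU1' hreg' (c₀ := c₀) (c₁ := c₁)) hpos' z‖ ≤
        γ₁⁻¹ * (CΔ * δ) * γ₁⁻¹ * ‖z‖ := h
    exact h'.trans (le_of_eq (by ring))
  · have h := norm_H1K_sub_le (𝕜 := ℂ) (E := BondL2K ℂ d (towerP L m (n + 1)) c₀ W) (F := BondL2K ℂ d m c₁ W) (S := SiteL2K ℂ d (towerP L m (n + 1)) c₀ W)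
      (Δ₁ := hessOp φ η U τ (c₀ := c₀)) (Δ₂ := hessOp φ η U' τ (c₀ := c₀))
      (D₁ := covDerivL2K ℂ c₀ ((η : ℂ))⁻¹ (adTransportW φ U)) (D₂ := covDerivL2K ℂ c₀ ((η : ℂ))⁻¹ (adTransportW φ U'))
      (R₁ := RofUk L m n φ η U (c₀ := c₀)) (R₂ := RofUk L m n φ η U' (c₀ := c₀))
      (Ds₁ := covDivL2K ℂ c₀ ((η : ℂ))⁻¹ (adTransportW φ fun b => (U b)⁻¹))
      (Ds₂ := covDivL2K ℂ c₀ ((η : ℂ))⁻¹ (adTransportW φ fun b => (U' b)⁻¹))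
      (Q₁ := QkW L m n φ U hL α hα1 hU1 hreg (c₀ := c₀) (c₁ := c₁))
      (Q₂ := QkW L m n φ U' hL α' hα1' hU1' hreg' (c₀ := c₀) (c₁ := c₁))
      (a := RCLike.ofReal a) (γ := γ₁) (MT := MT) (δT := CΔ * δ) hγ₁ hcoer hcoer' hMT hMT' hposU hposU' (by positivity) hδT
      (MQ := MQ1 + CQ) (μQ := μQ1 / 2) (δQ := CQ₂ * δ) (by positivity) hμ2 (by positivity) hQU hQU' hQUadj hQU'adj hQdiff₂
      (fun x' y' => (LinearMap.adjoint_inner_right _ x' y').symm) (adjoint_injective_of_modulus hμ2 hQUadj)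
      (fun x' y' => (LinearMap.adjoint_inner_right _ x' y').symm) (adjoint_injective_of_modulus hμ2 hQU'adj) hMT0 b
    have h' : ‖H1LatticeK (Δ₁ := hessOp φ η U τ) (Q := QkW L m n φ U hL α hα1 hU1 hreg (c₀ := c₀) (c₁ := c₁)) hpos hQs b -
        H1LatticeK (Δ₁ := hessOp φ η U' τ) (Q := QkW L m n φ U' hL α' hα1' hU1' hreg' (c₀ := c₀) (c₁ := c₁)) hpos' hQs' b‖ ≤
        (γ₁⁻¹ * (CΔ * δ) * γ₁⁻¹ * ((MQ1 + CQ) * (γ₁ * (μQ1 / 2) ^ 2 / MT ^ 2)⁻¹) + γ₁⁻¹ * (CQ₂ * δ * (γ₁ * (μQ1 / 2) ^ 2 / MT ^ 2)⁻¹) +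
          γ₁⁻¹ * ((MQ1 + CQ) * ((γ₁ * (μQ1 / 2) ^ 2 / MT ^ 2)⁻¹ * (CQ₂ * δ * (γ₁⁻¹ * (MQ1 + CQ)) +
            (MQ1 + CQ) * (γ₁⁻¹ * (CΔ * δ) * γ₁⁻¹ * (MQ1 + CQ)) + (MQ1 + CQ) * (γ₁⁻¹ * (CQ₂ * δ))) * (γ₁ * (μQ1 / 2) ^ 2 / MT ^ 2)⁻¹))) * ‖b‖ := h
    rw [← hκdef] at h'
    refine h'.trans ?_
    have hslack : 0 ≤ δ * ‖b‖ := mul_nonneg hδ (norm_nonneg b)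
    have hring : (γ₁⁻¹ * (CΔ * δ) * γ₁⁻¹ * ((MQ1 + CQ) * κ⁻¹) + γ₁⁻¹ * (CQ₂ * δ * κ⁻¹) +
          γ₁⁻¹ * ((MQ1 + CQ) * (κ⁻¹ * (CQ₂ * δ * (γ₁⁻¹ * (MQ1 + CQ)) +
            (MQ1 + CQ) * (γ₁⁻¹ * (CΔ * δ) * γ₁⁻¹ * (MQ1 + CQ)) + (MQ1 + CQ) * (γ₁⁻¹ * (CQ₂ * δ))) * κ⁻¹))) * ‖b‖ + δ * ‖b‖ =
        (γ₁⁻¹ * CΔ * γ₁⁻¹ * ((MQ1 + CQ) * κ⁻¹) + γ₁⁻¹ * (CQ₂ * κ⁻¹) +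
          γ₁⁻¹ * ((MQ1 + CQ) * (κ⁻¹ * (CQ₂ * (γ₁⁻¹ * (MQ1 + CQ)) + (MQ1 + CQ) * (γ₁⁻¹ * CΔ * γ₁⁻¹ * (MQ1 + CQ)) + (MQ1 + CQ) * (γ₁⁻¹ * CQ₂)) * κ⁻¹)) + 1) *
          δ * ‖b‖ := by ring
    exact (le_add_of_nonneg_right hslack).trans hring.le

end Assembled

end Literature.MathematicalPhysics.QuantumFieldTheory.Balaban1983to89.B9Eq386LipschitzH1TowerTwoBackgrounds

end
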